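import Summits.NavierStokesRegularity.NavierStokesRegularity.Theorems.StretchingWellBindingEnstrophyQuarterLawFiniteSingularSet
import Summits.NavierStokesRegularity.NavierStokesRegularity.Theorems.StretchingWellBindingEnstrophyQuarterLawSparsenessOfScarEnvelope
import Summits.NavierStokesRegularity.NavierStokesRegularity.Theorems.TypeIQuarterGateFiniteScarsTypeIOfQuarterLaw
import Summits.NavierStokesRegularity.NavierStokesRegularity.Theorems.TypeIQuarterGateLorentzUpgradeIffQuarterLaw
import Literature.Analysis.FluidPDE.ClassicalTopPointRegularity
import Summits.NavierStokesRegularity.NavierStokesRegularity.Theses.TypeIQuarterGate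
import Summits.NavierStokesRegularity.NavierStokesRegularity.Theses.TypeILiouville
import Summits.NavierStokesRegularity.NavierStokesRegularity.Theses.HalfHolderEnergy
import HarnessLib

/-!
# Shelf crux `EnstrophyQuarterLaw` (stmt-NavierStokesRegularity-1574), line «sparse_sieve»:
# the sparseness stub S2 ALONE drives route TypeIQuarterGate's cruxes K1 (23726) and FiniteScars (23842)

Helper file (`--supports stmt-NavierStokesRegularity-1574`; closes no registered stub). BY-NAME edges between the
registered open stub `stub_uniformSparseness` (S2, predicate `SparseSieve.UniformSparseness`) of the 1574 skeleton
`Cruxes/EnstrophyQuarterLaw/Lines/sparse_sieve.lean` and the cruxes of route TypeIQuarterGate: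

* `sliceQuarterLaw_of_isTypeIBlowup_of_uniformSparseness` — PER SOLUTION: at a sup-norm Type-I first blow-up,
  `UniformSparseness T u` alone gives Leray's slice quarter law `∫ |curl u(t)|² ≤ K/√(T − t)` (S1 is automatic on
  the Type-I stratum by `CountQuarterLaw.uniformLocalTypeI_of_isTypeIBlowup`; sieve `Registered.stub_sieve` with the
  known envelope / far-field stubs; converter `EnstrophyQuarterLaw.stub_windowToSlice`).
* `quarterLawTypeI_of_stub_uniformSparseness` — **(∀ first blow-ups, S2) ⟹ `QuarterLawTypeI`** (stmt-23726) with NO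
  appeal to `TypeIliouvilleNoTypeII` (0056); the tree had this only under 0056
  (`SparseSieveCharacterisation.quarterLawTypeI_iff_uniformLocalTypeI_and_uniformSparseness_of_noTypeII`).
* `lorentzUpgradeTypeI_of_stub_uniformSparseness` — (∀ S2) ⟹ `LorentzUpgradeTypeI` (24108, the active stub of
  23726's skeleton) ∧ `UniformConcentrationCountTypeI` (23970), by the tree's unconditional equivalences with K1.
* `finiteScarsTypeI_of_stub_uniformSparseness` — **(∀ S2) ⟹ `FiniteScarsTypeI`** (stmt-23842), through the landed
  `QuarterLawCountsScars` (23912); with the tree's converse edge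
  `EnvelopeSparseness.stub_uniformSparseness_of_scarSplit` (0056 ∧ 23842 ∧ 23843 ⟹ ∀ S2) this pins S2:
  `uniformSparseness_forall_iff_finiteScarsTypeI_of_noTypeII_of_scarEnvelope` — **given 0056 and `ScarEnvelopeTypeI`
  (23843), the 1574 line's private stub S2 is EQUIVALENT to TypeIQuarterGate's crux `FiniteScarsTypeI`.**
* The two formalisations of «singular point at the blow-up time» used by the two routes agree for classical
  solutions (`exists_bound_near_of_not_singular`, `singular_of_not_exists_bound_near`: essential unboundedness on all
  backward cylinders `(T − r², T) × B_r(x)` versus «no pointwise bound on any `[T − r², T) × B_r(x)`»), so the finite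
  singular set of `…FiniteSingularSet` is the scar finset of `QuarterLawCountsScars` / `FiniteScarsTypeI`
  (`exists_finset_scars_of_finite_singularSet`, `finite_singularSet_of_finset_scars`); consequently S1 ∧ S2 give the
  scar-finset form at EVERY first blow-up, Type I or not (`exists_finset_scars_of_uniformLocalTypeI_of_uniformSparseness`),
  and so does `EnergyHalfHolder` (25161) (`exists_finset_scars_of_energyHalfHolder`; the tree's
  `finiteScarsTypeI_of_energyHalfHolder` covers Type-I blow-ups).

* (appended) `quarterLawTypeI_iff_uniformSparseness_typeI` / `lorentzUpgradeTypeI_iff_uniformSparseness_typeI` —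
  **`QuarterLawTypeI` ⟺ `LorentzUpgradeTypeI` ⟺ (∀ Type-I first blow-ups, S2)** unconditionally (per solution on the
  Type-I stratum: S2 ⟺ slice quarter law, `uniformSparseness_iff_sliceQuarterLaw_of_isTypeIBlowup`).

RELATION TO EXISTING TREE CONTENT (honest): «Leray-rate enstrophy ⟹ finitely many singular points» per solution is
the landed item `QuarterLawCountsScars` (stmt-23912, route TypeIQuarterGate, CKN `E`-criterion); the sibling file
`…FiniteSingularSet` re-derives it from Barker–Prange concentration under the WEAKER per-solution hypothesis
S1 ∧ S2 (equivalently the window law), in the essential-supremum formalisation. HONEST FRAMING: implications between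
OPEN statements; no registered stub or crux is closed (1574, 0056, 23726, 23842, 23843, 25161 stay OPEN); nothing here
proves Navier–Stokes regularity.
-/

noncomputable section

-- the summit and its single sub-problem share the name (CONVENTIONS §1), as in every Theorems file
set_option linter.dupNamespace false

namespace Summit.NavierStokesRegularity.NavierStokesRegularity.Theorems.EnstrophyQuarterLaw.SparseSieve.FiniteSingularSet

open MeasureTheory Set Function Filter Topology TopologicalSpace Metric
open Literature.Analysis.FluidPDE
open scoped NNReal ENNReal

/-! ### S2 alone on the Type-I stratum -/

/-- **Per solution: sup-norm Type I ∧ uniform sparseness ⟹ Leray's slice quarter law.** At a first blow-up of a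
classical Leray–Hopf solution from a rapidly decaying datum with the Type-I rate `IsTypeIBlowup u T`, the predicate
`UniformSparseness T u` alone yields `∫ |curl u(t)|² ≤ K/√(T − t)` on `[0, T)`: S1 from Type I
(`CountQuarterLaw.uniformLocalTypeI_of_isTypeIBlowup`), the window law from the sieve (`Registered.stub_sieve` with
`Registered.stub_smoothingEnvelope`, `Registered.stub_farFieldEnstrophy`), the slice law from the Type-I converter
(`EnstrophyQuarterLaw.stub_windowToSlice`). S2 is a hypothesis; nothing unconditional is claimed. [folklore] -/
theorem sliceQuarterLaw_of_isTypeIBlowup_of_uniformSparseness {ν T : ℝ} (hν : 0 < ν) (hT : 0 < T)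
    {u : ℝ → EuclideanSpace ℝ (Fin 3) → EuclideanSpace ℝ (Fin 3)} {p : ℝ → EuclideanSpace ℝ (Fin 3) → ℝ}
    (hmax : IsMaximalSmoothSolution ν 0 u p T) (hLH : IsLerayHopfOn T ν 0 (u 0) u)
    (hdec : HasRapidSpatialDecay (u 0)) (hI : IsTypeIBlowup u T) (hS : UniformSparseness T u) :
    ∃ K : ℝ, ∀ t ∈ Ico 0 T, ∫⁻ x, ‖curl (u t) x‖ₑ ^ 2 ≤ ENNReal.ofReal (K / Real.sqrt (T - t)) := by
  have hS1 : UniformLocalTypeI T u :=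
    CountQuarterLaw.uniformLocalTypeI_of_isTypeIBlowup hν hT hmax.1 hLH hdec hI
  have hW : WindowLaw T u :=
    Registered.stub_sieve ν T hν hT u p hmax hLH hdec hS1 hS
      (Registered.stub_smoothingEnvelope ν T hν hT u p hmax hLH hdec)
      (Registered.stub_farFieldEnstrophy ν T hν hT u p hmax hLH hdec)
  exact _root_.Summit.NavierStokesRegularity.NavierStokesRegularity.Theorems.EnstrophyQuarterLaw.stub_windowToSlice
    ν T hν hT u p hmax hLH hdec hI hW

/-- **(∀ first blow-ups, S2) ⟹ `QuarterLawTypeI`** (crux stmt-NavierStokesRegularity-23726 of route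
TypeIQuarterGate) — WITHOUT the sibling stub `TypeIliouvilleNoTypeII` (0056): the registered signature of
`stub_uniformSparseness` alone implies the quarter law on the Type-I stratum, per solution
(`sliceQuarterLaw_of_isTypeIBlowup_of_uniformSparseness`). Implication between OPEN statements. [folklore] -/
theorem quarterLawTypeI_of_stub_uniformSparseness
    (hS2 : ∀ (ν T : ℝ), 0 < ν → 0 < T →
      ∀ (u : ℝ → EuclideanSpace ℝ (Fin 3) → EuclideanSpace ℝ (Fin 3))
        (p : ℝ → EuclideanSpace ℝ (Fin 3) → ℝ),
      IsMaximalSmoothSolution ν 0 u p T → IsLerayHopfOn T ν 0 (u 0) u →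
      HasRapidSpatialDecay (u 0) → UniformSparseness T u) :
    Summit.NavierStokesRegularity.NavierStokesRegularity.Theses.TypeIQuarterGate.QuarterLawTypeI := by
  unfold Summit.NavierStokesRegularity.NavierStokesRegularity.Theses.TypeIQuarterGate.QuarterLawTypeI
  intro ν T hν hT u p hmax hLH hdec hI
  exact sliceQuarterLaw_of_isTypeIBlowup_of_uniformSparseness hν hT hmax hLH hdec hI
    (hS2 ν T hν hT u p hmax hLH hdec)

/-- **(∀ first blow-ups, S2) ⟹ `FiniteScarsTypeI`** (crux stmt-NavierStokesRegularity-23842 of route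
TypeIQuarterGate): through `quarterLawTypeI_of_stub_uniformSparseness` and the landed count
`finiteScarsTypeI_of_quarterLawTypeI` (item `QuarterLawCountsScars`, 23912). Implication between OPEN statements.
[folklore] -/
theorem finiteScarsTypeI_of_stub_uniformSparseness
    (hS2 : ∀ (ν T : ℝ), 0 < ν → 0 < T →
      ∀ (u : ℝ → EuclideanSpace ℝ (Fin 3) → EuclideanSpace ℝ (Fin 3))
        (p : ℝ → EuclideanSpace ℝ (Fin 3) → ℝ),
      IsMaximalSmoothSolution ν 0 u p T → IsLerayHopfOn T ν 0 (u 0) u →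
      HasRapidSpatialDecay (u 0) → UniformSparseness T u) :
    Summit.NavierStokesRegularity.NavierStokesRegularity.Theses.TypeIQuarterGate.FiniteScarsTypeI :=
  finiteScarsTypeI_of_quarterLawTypeI (quarterLawTypeI_of_stub_uniformSparseness hS2)

/-- **(∀ first blow-ups, S2) ⟹ `LorentzUpgradeTypeI`** (stmt-NavierStokesRegularity-24108, the only active stub
`stub_lorentzUpgrade` of the registered skeleton of crux 23726) **and ⟹ `UniformConcentrationCountTypeI`**
(stmt-23970): through `quarterLawTypeI_of_stub_uniformSparseness` and the tree's unconditional equivalences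
`LorentzOfEnvelope.lorentzUpgradeTypeI_iff_quarterLawTypeI`, `…_iff_uniformConcentrationCountTypeI`. So the 1574
line's sparseness stub dominates the whole Type-I crux family of route TypeIQuarterGate. Implications between OPEN
statements. [folklore] -/
theorem lorentzUpgradeTypeI_of_stub_uniformSparseness
    (hS2 : ∀ (ν T : ℝ), 0 < ν → 0 < T →
      ∀ (u : ℝ → EuclideanSpace ℝ (Fin 3) → EuclideanSpace ℝ (Fin 3))
        (p : ℝ → EuclideanSpace ℝ (Fin 3) → ℝ),
      IsMaximalSmoothSolution ν 0 u p T → IsLerayHopfOn T ν 0 (u 0) u →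
      HasRapidSpatialDecay (u 0) → UniformSparseness T u) :
    Summit.NavierStokesRegularity.NavierStokesRegularity.Theses.TypeIQuarterGate.LorentzUpgradeTypeI ∧
      Summit.NavierStokesRegularity.NavierStokesRegularity.Theses.TypeIQuarterGate.UniformConcentrationCountTypeI :=
  have hL := LorentzOfEnvelope.lorentzUpgradeTypeI_of_quarterLawTypeI
    (quarterLawTypeI_of_stub_uniformSparseness hS2)
  ⟨hL, LorentzOfEnvelope.lorentzUpgradeTypeI_iff_uniformConcentrationCountTypeI.1 hL⟩

/-- **S2 pinned between the scar cruxes of route TypeIQuarterGate.** Given `TypeIliouvilleNoTypeII` (0056) and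
`ScarEnvelopeTypeI` (23843), the registered sparseness stub of the 1574 line holds at every first blow-up **iff**
`FiniteScarsTypeI` (23842): `⇒` is `finiteScarsTypeI_of_stub_uniformSparseness` (which needs neither hypothesis),
`⇐` is the tree's `EnvelopeSparseness.stub_uniformSparseness_of_scarSplit`. Equivalence of OPEN statements under
OPEN hypotheses; nothing is asserted. [folklore] -/
theorem uniformSparseness_forall_iff_finiteScarsTypeI_of_noTypeII_of_scarEnvelope
    (hS6 : Summit.NavierStokesRegularity.NavierStokesRegularity.Theses.TypeILiouville.TypeIliouvilleNoTypeII)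
    (henv : Summit.NavierStokesRegularity.NavierStokesRegularity.Theses.TypeIQuarterGate.ScarEnvelopeTypeI) :
    (∀ (ν T : ℝ), 0 < ν → 0 < T →
      ∀ (u : ℝ → EuclideanSpace ℝ (Fin 3) → EuclideanSpace ℝ (Fin 3))
        (p : ℝ → EuclideanSpace ℝ (Fin 3) → ℝ),
      IsMaximalSmoothSolution ν 0 u p T → IsLerayHopfOn T ν 0 (u 0) u →
      HasRapidSpatialDecay (u 0) → UniformSparseness T u) ↔
    Summit.NavierStokesRegularity.NavierStokesRegularity.Theses.TypeIQuarterGate.FiniteScarsTypeI :=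
  ⟨finiteScarsTypeI_of_stub_uniformSparseness,
    fun hscars => EnvelopeSparseness.stub_uniformSparseness_of_scarSplit hS6 hscars henv⟩

/-! ### The two formalisations of «singular point at time `T`» agree for classical solutions -/

/-- **Not essentially singular ⟹ a pointwise bound near `(T, x)`**, for a classical solution on `[0, T)`:
if `u` is essentially bounded on SOME backward cylinder `(T − r², T) × B_r(x)` (`0 < r`, `r² < T`), then
`‖u(t, y)‖ ≤ A` on `[T − (r/2)², T) × B_{r/2}(x)` — essential bounds of a function continuous on the open cylinder
are pointwise bounds (`exists_forall_norm_le_of_eLpNorm_top_lt_top`). [folklore] -/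
theorem exists_bound_near_of_not_singular {ν T : ℝ}
    {u : ℝ → EuclideanSpace ℝ (Fin 3) → EuclideanSpace ℝ (Fin 3)} {p : ℝ → EuclideanSpace ℝ (Fin 3) → ℝ}
    (hcl : IsClassicalNSSolutionOn (Ico 0 T) ν 0 u p) {x : EuclideanSpace ℝ (Fin 3)}
    (hx : ¬ ∀ r : ℝ, 0 < r → r ^ 2 < T →
      eLpNorm (uncurry u) ∞ (volume.restrict (parabolicCylinder r ((T : ℝ), x))) = ∞) :
    ∃ r : ℝ, 0 < r ∧ ∃ A : ℝ, ∀ t ∈ Ico (T - r ^ 2) T, ∀ y ∈ ball x r, ‖u t y‖ ≤ A := by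
  obtain ⟨r, hr, hrT, hne⟩ : ∃ r : ℝ, 0 < r ∧ r ^ 2 < T ∧
      eLpNorm (uncurry u) ∞ (volume.restrict (parabolicCylinder r ((T : ℝ), x))) ≠ ∞ := by
    by_contra h
    exact hx fun r hr hrT => by
      by_contra hne
      exact h ⟨r, hr, hrT, hne⟩
  have hfin : eLpNorm (uncurry u) ∞ (volume.restrict (parabolicCylinder r ((T : ℝ), x))) < ⊤ :=
    lt_top_iff_ne_top.2 hne
  -- the open cylinder lies in the strip `[0, T) × ℝ³`, where `u` is continuous
  have hsub : parabolicCylinder r ((T : ℝ), x) ⊆ Ico 0 T ×ˢ (univ : Set (EuclideanSpace ℝ (Fin 3))) := by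
    rintro ⟨s, y⟩ hz
    rw [mem_parabolicCylinder] at hz
    exact ⟨⟨by linarith [hz.1.1], hz.1.2⟩, mem_univ _⟩
  have hcont : ContinuousOn (uncurry u) (parabolicCylinder r ((T : ℝ), x)) :=
    hcl.smooth_velocity.continuousOn.mono hsub
  have hbd := exists_forall_norm_le_of_eLpNorm_top_lt_top (μ := volume)
    (isOpen_parabolicCylinder r ((T : ℝ), x)) hcont hfin
  refine ⟨r / 2, by positivity, (eLpNorm (uncurry u) ∞
    (volume.restrict (parabolicCylinder r ((T : ℝ), x)))).toReal, fun t ht y hy => ?_⟩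
  have hmem : ((t, y) : ℝ × EuclideanSpace ℝ (Fin 3)) ∈ parabolicCylinder r ((T : ℝ), x) := by
    rw [mem_parabolicCylinder]
    refine ⟨⟨?_, ht.2⟩, ?_⟩
    · have h1 : (r / 2) ^ 2 < r ^ 2 := by nlinarith
      simp only
      linarith [ht.1]
    · simpa only using (mem_ball.1 hy).trans_le (by linarith : r / 2 ≤ r)
  exact hbd (t, y) hmem

/-- **No pointwise bound near `(T, x)` ⟹ essentially singular** (contrapositive packaging of
`exists_bound_near_of_not_singular`): the scar points of `QuarterLawCountsScars` / `FiniteScarsTypeI` are singular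
points in the essential-supremum sense of `BarkerPrange2020_thm2`. [folklore] -/
theorem singular_of_not_exists_bound_near {ν T : ℝ}
    {u : ℝ → EuclideanSpace ℝ (Fin 3) → EuclideanSpace ℝ (Fin 3)} {p : ℝ → EuclideanSpace ℝ (Fin 3) → ℝ}
    (hcl : IsClassicalNSSolutionOn (Ico 0 T) ν 0 u p) {x : EuclideanSpace ℝ (Fin 3)}
    (hx : ¬ ∃ r : ℝ, 0 < r ∧ ∃ A : ℝ, ∀ t ∈ Ico (T - r ^ 2) T, ∀ y ∈ ball x r, ‖u t y‖ ≤ A) :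
    ∀ r : ℝ, 0 < r → r ^ 2 < T →
      eLpNorm (uncurry u) ∞ (volume.restrict (parabolicCylinder r ((T : ℝ), x))) = ∞ := by
  by_contra h
  exact hx (exists_bound_near_of_not_singular hcl h)

/-- **A pointwise bound near `(T, x)` ⟹ not essentially singular**: if `‖u‖ ≤ A` on `[T − r², T) × B_r(x)` then
`u` is essentially bounded on the backward cylinder of radius `min r (√T/2)` (which is admissible: its square is
`< T`). [folklore] -/
theorem not_singular_of_exists_bound_near {T : ℝ} (hT : 0 < T)
    {u : ℝ → EuclideanSpace ℝ (Fin 3) → EuclideanSpace ℝ (Fin 3)} {x : EuclideanSpace ℝ (Fin 3)}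
    (hx : ∃ r : ℝ, 0 < r ∧ ∃ A : ℝ, ∀ t ∈ Ico (T - r ^ 2) T, ∀ y ∈ ball x r, ‖u t y‖ ≤ A) :
    ¬ ∀ r : ℝ, 0 < r → r ^ 2 < T →
      eLpNorm (uncurry u) ∞ (volume.restrict (parabolicCylinder r ((T : ℝ), x))) = ∞ := by
  obtain ⟨r, hr, A, hA⟩ := hx
  intro h
  set ρ : ℝ := min r (Real.sqrt T / 2) with hρdef
  have hsq : 0 < Real.sqrt T := Real.sqrt_pos.2 hT
  have hρ : 0 < ρ := lt_min hr (by positivity)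
  have hρr : ρ ≤ r := min_le_left _ _
  have hρT : ρ ^ 2 < T := by
    have h1 : ρ ≤ Real.sqrt T / 2 := min_le_right _ _
    have h2 : ρ ^ 2 ≤ (Real.sqrt T / 2) ^ 2 := pow_le_pow_left₀ hρ.le h1 2
    have h3 : (Real.sqrt T / 2) ^ 2 = T / 4 := by rw [div_pow, Real.sq_sqrt hT.le]; norm_num
    linarith
  have hbd : eLpNorm (uncurry u) ∞ (volume.restrict (parabolicCylinder ρ ((T : ℝ), x))) < ∞ := by
    rw [eLpNorm_exponent_top]
    refine eLpNormEssSup_lt_top_of_ae_bound (C := A) ?_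
    filter_upwards [ae_restrict_mem (isOpen_parabolicCylinder ρ ((T : ℝ), x)).measurableSet] with z hz
    rw [mem_parabolicCylinder] at hz
    have hρ2 : ρ ^ 2 ≤ r ^ 2 := pow_le_pow_left₀ hρ.le hρr 2
    exact hA z.1 ⟨by simp only at hz; linarith [hz.1.1], hz.1.2⟩ z.2
      (mem_ball.2 (hz.2.trans_le hρr))
  exact hbd.ne (h ρ hρ hρT)

/-- **Finite essential singular set ⟹ scar finset** (the conclusion shape of `QuarterLawCountsScars` and
`FiniteScarsTypeI`), for a classical solution on `[0, T)`. [folklore] -/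
theorem exists_finset_scars_of_finite_singularSet {ν T : ℝ}
    {u : ℝ → EuclideanSpace ℝ (Fin 3) → EuclideanSpace ℝ (Fin 3)} {p : ℝ → EuclideanSpace ℝ (Fin 3) → ℝ}
    (hcl : IsClassicalNSSolutionOn (Ico 0 T) ν 0 u p)
    (hfin : Set.Finite {x₀ : EuclideanSpace ℝ (Fin 3) | ∀ r : ℝ, 0 < r → r ^ 2 < T →
      eLpNorm (uncurry u) ∞ (volume.restrict (parabolicCylinder r ((T : ℝ), x₀))) = ∞}) :
    ∃ σ : Finset (EuclideanSpace ℝ (Fin 3)), ∀ x ∉ σ, ∃ r : ℝ, 0 < r ∧ ∃ A : ℝ,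
      ∀ t ∈ Ico (T - r ^ 2) T, ∀ y ∈ ball x r, ‖u t y‖ ≤ A :=
  ⟨hfin.toFinset, fun _ hx =>
    exists_bound_near_of_not_singular hcl fun h => hx (hfin.mem_toFinset.2 h)⟩

/-- **Scar finset ⟹ finite essential singular set** (converse bookkeeping). [folklore] -/
theorem finite_singularSet_of_finset_scars {T : ℝ} (hT : 0 < T)
    {u : ℝ → EuclideanSpace ℝ (Fin 3) → EuclideanSpace ℝ (Fin 3)}
    {σ : Finset (EuclideanSpace ℝ (Fin 3))}
    (hσ : ∀ x ∉ σ, ∃ r : ℝ, 0 < r ∧ ∃ A : ℝ, ∀ t ∈ Ico (T - r ^ 2) T, ∀ y ∈ ball x r, ‖u t y‖ ≤ A) :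
    Set.Finite {x₀ : EuclideanSpace ℝ (Fin 3) | ∀ r : ℝ, 0 < r → r ^ 2 < T →
      eLpNorm (uncurry u) ∞ (volume.restrict (parabolicCylinder r ((T : ℝ), x₀))) = ∞} := by
  refine σ.finite_toSet.subset fun x hx => ?_
  by_contra hxσ
  exact not_singular_of_exists_bound_near hT (hσ x hxσ) hx

/-! ### Scar-finset forms at EVERY first blow-up (Type I or not) -/

/-- **S1 ∧ S2 ⟹ finitely many scars, per solution, scar-finset form**: for a classical Leray–Hopf solution on
`[0, T)` from a rapidly decaying datum with `UniformLocalTypeI T u` and `UniformSparseness T u`, off a finite set of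
points `u` is pointwise bounded on a backward neighbourhood `[T − r², T) × B_r(x)` of `(T, x)`. No Type-I rate is
assumed (compare `FiniteScarsTypeI`, which quantifies over Type-I blow-ups only). [folklore] -/
theorem exists_finset_scars_of_uniformLocalTypeI_of_uniformSparseness {ν T : ℝ} (hν : 0 < ν) (hT : 0 < T)
    {u : ℝ → EuclideanSpace ℝ (Fin 3) → EuclideanSpace ℝ (Fin 3)} {p : ℝ → EuclideanSpace ℝ (Fin 3) → ℝ}
    (hcl : IsClassicalNSSolutionOn (Ico 0 T) ν 0 u p) (hLH : IsLerayHopfOn T ν 0 (u 0) u)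
    (hdec : HasRapidSpatialDecay (u 0)) (hA : UniformLocalTypeI T u) (hS : UniformSparseness T u) :
    ∃ σ : Finset (EuclideanSpace ℝ (Fin 3)), ∀ x ∉ σ, ∃ r : ℝ, 0 < r ∧ ∃ A : ℝ,
      ∀ t ∈ Ico (T - r ^ 2) T, ∀ y ∈ ball x r, ‖u t y‖ ≤ A :=
  exists_finset_scars_of_finite_singularSet hcl
    (finite_singularSet_of_uniformLocalTypeI_of_uniformSparseness hν hT hcl hLH hdec hA hS)

/-- **`EnergyHalfHolder` (stmt-NavierStokesRegularity-25161) ⟹ finitely many scars at EVERY first blow-up**,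
scar-finset form (the tree's `finiteScarsTypeI_of_energyHalfHolder` is the Type-I-stratum statement
`FiniteScarsTypeI`; here no Type-I rate is assumed). Implication from an OPEN statement. [folklore] -/
theorem exists_finset_scars_of_energyHalfHolder
    (hH : Summit.NavierStokesRegularity.NavierStokesRegularity.Theses.HalfHolderEnergy.EnergyHalfHolder)
    {ν T : ℝ} (hν : 0 < ν) (hT : 0 < T)
    {u : ℝ → EuclideanSpace ℝ (Fin 3) → EuclideanSpace ℝ (Fin 3)} {p : ℝ → EuclideanSpace ℝ (Fin 3) → ℝ}
    (hmax : IsMaximalSmoothSolution ν 0 u p T) (hLH : IsLerayHopfOn T ν 0 (u 0) u)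
    (hdec : HasRapidSpatialDecay (u 0)) :
    ∃ σ : Finset (EuclideanSpace ℝ (Fin 3)), ∀ x ∉ σ, ∃ r : ℝ, 0 < r ∧ ∃ A : ℝ,
      ∀ t ∈ Ico (T - r ^ 2) T, ∀ y ∈ ball x r, ‖u t y‖ ≤ A :=
  exists_finset_scars_of_finite_singularSet hmax.1
    (finite_singularSet_of_energyHalfHolder hH ν T hν hT u p hmax hLH hdec)

/-! ### `QuarterLawTypeI` characterised in the sparse-sieve currency (appended 2026-08-31) -/

/-- **Per solution: Leray's slice quarter law ⟹ uniform sparseness**, for ANY maximal smooth Leray–Hopf solution from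
a rapidly decaying datum (no Type-I rate): slice law ⟹ window law (`WindowConverters.lintegral_Ioo_le_sqrt_of_slice_le`)
⟹ S2 (`SparsenessCoarse.uniformSparseness_of_window` with the far field `Registered.stub_farFieldEnstrophy`). The
per-solution content of `Registered.stub_uniformSparseness_of_enstrophyQuarterLaw`. [folklore] -/
theorem uniformSparseness_of_sliceQuarterLaw {ν T : ℝ} (hν : 0 < ν) (hT : 0 < T)
    {u : ℝ → EuclideanSpace ℝ (Fin 3) → EuclideanSpace ℝ (Fin 3)} {p : ℝ → EuclideanSpace ℝ (Fin 3) → ℝ}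
    (hmax : IsMaximalSmoothSolution ν 0 u p T) (hLH : IsLerayHopfOn T ν 0 (u 0) u)
    (hdec : HasRapidSpatialDecay (u 0)) {K : ℝ}
    (hZ : ∀ t ∈ Ico 0 T, ∫⁻ x, ‖curl (u t) x‖ₑ ^ 2 ≤ ENNReal.ofReal (K / Real.sqrt (T - t))) :
    UniformSparseness T u := by
  have hZ' : ∀ t ∈ Ico 0 T,
      ∫⁻ x, ‖curl (u t) x‖ₑ ^ 2 ≤ ENNReal.ofReal (max K 0 / Real.sqrt (T - t)) :=
    fun t ht => (hZ t ht).trans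
      (ENNReal.ofReal_le_ofReal (div_le_div_of_nonneg_right (le_max_left _ _) (Real.sqrt_nonneg _)))
  have hwin : ∀ a b : ℝ, 0 ≤ a → a ≤ b → b ≤ T →
      ∫⁻ t in Ioo a b, ∫⁻ x, ‖curl (u t) x‖ₑ ^ 2 ≤ ENNReal.ofReal (2 * max K 0 * Real.sqrt (b - a)) :=
    fun a b ha hab hb => WindowConverters.lintegral_Ioo_le_sqrt_of_slice_le (le_max_right K 0) hZ' ha hab hb
  obtain ⟨ρ, B, hB, hFF⟩ := Registered.stub_farFieldEnstrophy ν T hν hT u p hmax hLH hdec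
  exact SparsenessCoarse.uniformSparseness_of_window hν hT hmax.1 hLH hdec (by positivity) hwin hB hFF

/-- **Per solution, on the Type-I stratum: uniform sparseness ⟺ Leray's slice quarter law.** For a sup-norm Type-I
first blow-up (`IsTypeIBlowup u T`), `UniformSparseness T u` holds iff `∫ |curl u(t)|² ≤ K/√(T − t)` for some `K`
(`⇒` `sliceQuarterLaw_of_isTypeIBlowup_of_uniformSparseness`, `⇐` `uniformSparseness_of_sliceQuarterLaw`).
[folklore] -/
theorem uniformSparseness_iff_sliceQuarterLaw_of_isTypeIBlowup {ν T : ℝ} (hν : 0 < ν) (hT : 0 < T)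
    {u : ℝ → EuclideanSpace ℝ (Fin 3) → EuclideanSpace ℝ (Fin 3)} {p : ℝ → EuclideanSpace ℝ (Fin 3) → ℝ}
    (hmax : IsMaximalSmoothSolution ν 0 u p T) (hLH : IsLerayHopfOn T ν 0 (u 0) u)
    (hdec : HasRapidSpatialDecay (u 0)) (hI : IsTypeIBlowup u T) :
    UniformSparseness T u ↔
      ∃ K : ℝ, ∀ t ∈ Ico 0 T, ∫⁻ x, ‖curl (u t) x‖ₑ ^ 2 ≤ ENNReal.ofReal (K / Real.sqrt (T - t)) :=
  ⟨sliceQuarterLaw_of_isTypeIBlowup_of_uniformSparseness hν hT hmax hLH hdec hI,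
    fun ⟨_, hK⟩ => uniformSparseness_of_sliceQuarterLaw hν hT hmax hLH hdec hK⟩

/-- **`QuarterLawTypeI` (stmt-NavierStokesRegularity-23726) ⟺ uniform sparseness on the Type-I stratum**, BY NAME
and unconditionally: the crux of route TypeIQuarterGate holds iff every sup-norm Type-I first blow-up of a classical
Leray–Hopf solution from a rapidly decaying datum has uniformly sparse `L³`-concentration (predicate
`SparseSieve.UniformSparseness` of the 1574 line). Joins the tree's `QuarterLawTypeI ⟺ LorentzUpgradeTypeI ⟺
UniformConcentrationCountTypeI` (`LorentzOfEnvelope.lorentzUpgradeTypeI_iff_quarterLawTypeI`, …): the `E`-currency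
count, the weak-`L³` slice bound and the `L³`-slice sparseness are one statement on the Type-I stratum. Equivalence of
OPEN statements; neither side is asserted. [folklore] -/
theorem quarterLawTypeI_iff_uniformSparseness_typeI :
    Summit.NavierStokesRegularity.NavierStokesRegularity.Theses.TypeIQuarterGate.QuarterLawTypeI ↔
      ∀ (ν T : ℝ), 0 < ν → 0 < T →
        ∀ (u : ℝ → EuclideanSpace ℝ (Fin 3) → EuclideanSpace ℝ (Fin 3))
          (p : ℝ → EuclideanSpace ℝ (Fin 3) → ℝ),
        IsMaximalSmoothSolution ν 0 u p T → IsLerayHopfOn T ν 0 (u 0) u →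
        HasRapidSpatialDecay (u 0) → IsTypeIBlowup u T → UniformSparseness T u := by
  unfold Summit.NavierStokesRegularity.NavierStokesRegularity.Theses.TypeIQuarterGate.QuarterLawTypeI
  constructor
  · intro hK1 ν T hν hT u p hmax hLH hdec hI
    obtain ⟨K, hK⟩ := hK1 ν T hν hT u p hmax hLH hdec hI
    exact uniformSparseness_of_sliceQuarterLaw hν hT hmax hLH hdec hK
  · intro hS2 ν T hν hT u p hmax hLH hdec hI
    exact sliceQuarterLaw_of_isTypeIBlowup_of_uniformSparseness hν hT hmax hLH hdec hI
      (hS2 ν T hν hT u p hmax hLH hdec hI)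

/-- **`LorentzUpgradeTypeI` (stmt-24108) ⟺ uniform sparseness on the Type-I stratum**, by the previous theorem and
the tree's `LorentzUpgradeTypeI ⟺ QuarterLawTypeI`. Equivalence of OPEN statements. [folklore] -/
theorem lorentzUpgradeTypeI_iff_uniformSparseness_typeI :
    Summit.NavierStokesRegularity.NavierStokesRegularity.Theses.TypeIQuarterGate.LorentzUpgradeTypeI ↔
      ∀ (ν T : ℝ), 0 < ν → 0 < T →
        ∀ (u : ℝ → EuclideanSpace ℝ (Fin 3) → EuclideanSpace ℝ (Fin 3))
          (p : ℝ → EuclideanSpace ℝ (Fin 3) → ℝ),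
        IsMaximalSmoothSolution ν 0 u p T → IsLerayHopfOn T ν 0 (u 0) u →
        HasRapidSpatialDecay (u 0) → IsTypeIBlowup u T → UniformSparseness T u :=
  LorentzOfEnvelope.lorentzUpgradeTypeI_iff_quarterLawTypeI.trans quarterLawTypeI_iff_uniformSparseness_typeI

end Summit.NavierStokesRegularity.NavierStokesRegularity.Theorems.EnstrophyQuarterLaw.SparseSieve.FiniteSingularSet

end
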